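import Literature.Geometry.Kaehler.ComplexTorusHodgeGeneralAbelianSurfacesProduct
import Literature.Geometry.Kaehler.ComplexTorusAbelianSurfaceComplexMultiplicationHodgeLieAlgebraDimension
import Literature.Geometry.Kaehler.ComplexTorusSimpleEndomorphismCenter
import Literature.Geometry.Kaehler.ComplexTorusMumfordTateGroupRadicalDerivedProduct
import Literature.Geometry.Kaehler.ComplexTorusHodgeGroupProductPerfectFactor
import Literature.Geometry.Kaehler.ComplexTorusHodgeGroupAnalyticallyConnected
import Literature.Geometry.Kaehler.ComplexTorusMumfordTateGroupDerivedGroup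
import HarnessLib

/-!
# A simple abelian variety with totally real centre times a variety of CM type: `Hg(X₁ × X₂) = Hg(X₁) × Hg(X₂)`
# (Moonen–Zarhin's Theorem (3.2)(2) for simple `X₁`); for abelian SURFACES: `Hg(Y)(ℂ)` of a simple `Y` is perfect or
# commutative, and `Y₁ × Y₂` satisfies condition (D) whenever exactly one Hodge group is commutative

Lane `lit-hodgefound`, seat p17, generation 52, self-proposed row g52-#3 — sequel of g52-#2
(`ComplexTorusHodgeGeneralAbelianSurfacesProduct`: type I(1) pairs) in the programme «Moonen–Zarhin Thm. (0.1)(4) for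
`X ∼ Y₁ × Y₂`».  THEOREMS ONLY (no definition, no instance, no notation, no named fact; D-0026 net debt 0); everything is
consumed BY NAME from the tree: MZ §1 ∕ Gordon 2.9 «no factors of Type IV ⟹ `Hg` semisimple» in the arithmetic form
`IsRiemannForm.commutator_hodgeGroupC_eq_self_of_forall_rosati_eq` (Rosati-fixed centre ⟹ `Hg(X)(ℂ)` perfect), the centre
dichotomy of a simple polarised torus (`IsSimple.centerField_isTotallyReal_or_isCMField`, «first kind ⟺ `K` totally real»
`IsSimple.forall_rosati_val_eq_iff_isTotallyReal`), Gordon's lemma «perfect × torus splits»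
(`hodgeGroupC_prod_eq_blockDiagProd_of_commutator_eq`), the CM surface `Hg(X) = U_F` (`IsSimple.hodgeGroup_comm_of_isCMField_of_finrank_eq_two`).

## Sources, verbatim

* B. Moonen, Yu. G. Zarhin [MoonenZarhin1999LowDim], held `paper:arxiv-math_9901113`: §1 (p0002 L134–L136) «The Hodge group
  `Hg(X)` is a torus if and only if `X` is of CM-type. If `X` has no factors of Type IV then `Hg(X)` is semi-simple.»;
  §3 Theorem (3.2) (Hazama) (p0006 L70–L78) «Let `X₁` and `X₂` be complex abelian varieties which both satisfy condition (D)
  […] (2) Suppose `X₁` has no factors of Type IV and `X₂` is of CM-type. Then `X₁ × X₂` again satisfies (D) and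
  `Hg(X₁ × X₂) = Hg(X₁) × Hg(X₂)`.»; §2 (2.2) `g = 2` (p0005 L53–L78: the four simple types I(1), I(2), II(1), IV(2,1),
  «Type IV(2,1): […] We have `Hg(X) = U_F`»); §5 (5.4) (p0009 L82–L92: «Suppose `X` is not of CM-type. Then `X` contains a
  simple abelian subvariety `X₂` which is not of CM-type. We can write `X ∼ X₁ × X₂^r` […] If `dim(X₂) < 3` then the desired
  equality `Hg(X) = Hg(X₁) × Hg(X₂)` follows from (3.2) and (3.3)»); Thm. (0.1)(4) (p0001 L131–L135).
* H. Lange [Lange2023AbelianVarietiesComplex], §2.6.2 (p. 141: «of the first kind if the anti-involution is trivial on the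
  centre `K` of `F`», Lemma 2.6.4: first kind ⟺ `K` totally real), §5.1.5 Exercise (2)(b) (simple surfaces).
* B. B. Gordon [Gordon1997], §2.9 Proposition («no type IV ⟹ `Hg` semisimple»), §2.12 Proposition, §3 Theorem (proof:
  «if `A` is `B × C` with `Hg(B)` a torus and `Hg(C)` semisimple, then `Hg(A) = Hg(B) × Hg(C)`»).

## What is proved

* §1 (any dimension) **`IsSimple.commutator_hodgeGroupC_eq_self_of_isTotallyReal_centerField`** — a simple polarised complex
  torus whose endomorphism algebra has TOTALLY REAL centre (Albert types I–III: «no factor of Type IV») has PERFECT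
  `Hg(X)(ℂ)`; **`IsSimple.hodgeGroupC_prod_eq_blockDiagProd_of_isTotallyReal_centerField_of_commutator_eq_bot`** (and the
  mirror) — MZ Thm. (3.2)(2) for simple `X₁`: `X₁` simple with totally real centre, `Hg(X₂)(ℂ)` commutative ⟹
  `Hg(X₁ × X₂)(ℂ) = Hg(X₁)(ℂ) × Hg(X₂)(ℂ)`, with the (D)-transfer.
* §2 (surfaces) **`IsSimple.commutator_hodgeGroupC_eq_self_or_eq_bot_of_finrank_eq_two`** — for a SIMPLE abelian surface
  `Hg(Y)(ℂ)` is perfect (types I(1), I(2), II(1)) or commutative (type IV(2,1));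
  `IsSimple.commutator_hodgeGroupC_eq_self_of_not_hodgeGroup_comm_of_finrank_eq_two`;
  **`IsRiemannForm.hodgeGroupC_prod_eq_blockDiagProd_of_hodgeGroup_comm_of_not_hodgeGroup_comm_of_finrank_eq_two`** (+ mirror):
  `Y₁` with commutative, `Y₂` simple with non-commutative Hodge group ⟹ the Hodge group of `Y₁ × Y₂` splits;
  **`IsRiemannForm.forall_divisorClasses_powPeriod_prod_eq_hodgeClasses_of_hodgeGroup_comm_of_not_hodgeGroup_comm_of_finrank_eq_two`**
  (+ mirror): (D) for `Y₁ × Y₂` when exactly one of `Hg(Y₁)`, `Hg(Y₂)` is commutative; and the assembly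
  **`IsRiemannForm.forall_divisorClasses_powPeriod_prod_eq_hodgeClasses_of_finrank_eq_two_of_endAlgRat_eq_bot_or'`** —
  `Y₁ × Y₂` satisfies (D) unless both factors are simple, non-isogenous, with `End_ℚ ≠ ℚ` and with Hodge groups BOTH
  commutative (CM × CM: MZ Prop. (4.2)) or BOTH non-commutative (pairs of types I(2) ∕ II(1): MZ Thm. (3.2)(1)); `IsAbelianVariety`,
  isogeny-class and cycle forms.

## References

* [MoonenZarhin1999LowDim] B. Moonen, Yu. G. Zarhin, Math. Ann. 315 (1999), §1, §2 (2.2), §3 Thm. (3.2), §5 (5.4)–(5.5), Thm. (0.1)(4).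
* [Lange2023AbelianVarietiesComplex] H. Lange, *Abelian Varieties over the Complex Numbers* (2023), §2.6.2, §5.1.5.
* [Gordon1997] B. B. Gordon, *A survey of the Hodge conjecture for abelian varieties*, §2.9, §2.12, §3 Theorem.
-/

noncomputable section

open Matrix Module NumberField

namespace Literature.Geometry.Kaehler

namespace ComplexTorus

/-! ## §1 Simple with totally real centre: `Hg(X)(ℂ)` is perfect; times CM it splits (any dimensions) -/

section AnyDimension

variable {ι₁ ι₂ : Type*} [Fintype ι₁] [DecidableEq ι₁] [Fintype ι₂] [DecidableEq ι₂]
  {E₁ E₂ : Type*} [NormedAddCommGroup E₁] [NormedSpace ℂ E₁] [NormedAddCommGroup E₂] [NormedSpace ℂ E₂]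
  {Φ₁ : (ι₁ → ℝ) ≃L[ℝ] E₁} {Φ₂ : (ι₂ → ℝ) ≃L[ℝ] E₂} {η₁ : E₁ [⋀^Fin 2]→L[ℝ] ℝ} {η₂ : E₂ [⋀^Fin 2]→L[ℝ] ℝ}

/-- **A SIMPLE polarised complex torus whose endomorphism algebra has totally real centre has PERFECT `Hg(X)(ℂ)`** («If `X` has no
factors of Type IV then `Hg(X)` is semi-simple»: the Rosati involution is the identity on a totally real centre — first kind — and
a Rosati-fixed centre makes `Hg(X)(ℂ)` perfect). [cite: MoonenZarhin1999LowDim, §1 (p0002 L134–L136)] [cite: Gordon1997, §2.9 Proposition]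
[cite: Lange2023AbelianVarietiesComplex, §2.6.2 (p. 141) and Lemma 2.6.4] -/
theorem IsSimple.commutator_hodgeGroupC_eq_self_of_isTotallyReal_centerField [Nonempty ι₁] (hX : IsSimple Φ₁)
    (hη : IsRiemannForm Φ₁ η₁) [IsTotallyReal (centerField Φ₁ hX)] : ⁅hodgeGroupC Φ₁, hodgeGroupC Φ₁⁆ = hodgeGroupC Φ₁ := by
  obtain ⟨G, hG⟩ := hη.exists_ratMatrix_latticeGram
  refine (hη.commutator_hodgeGroupC_eq_self_of_forall_rosati_eq hG fun B hB hc ↦ ?_).1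
  obtain ⟨z, rfl⟩ := centerField.exists_val_eq Φ₁ hX hB hc
  exact (hX.forall_rosati_val_eq_iff_isTotallyReal hη hG).2 ‹_› z

/-- **MOONEN–ZARHIN THM. (3.2)(2) FOR SIMPLE `X₁`: `X₁` simple with totally real centre (no factor of Type IV), `Hg(X₂)(ℂ)`
commutative (`X₂` of CM type) ⟹ `Hg(X₁ × X₂)(ℂ) = Hg(X₁)(ℂ) × Hg(X₂)(ℂ)`** (Gordon's lemma: perfect × torus).
[cite: MoonenZarhin1999LowDim, §3 Theorem (3.2)(2) (p0006 L74–L78)] [cite: Gordon1997, §3 Theorem, proof (p0014 L33–L37)] -/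
theorem IsSimple.hodgeGroupC_prod_eq_blockDiagProd_of_isTotallyReal_centerField_of_commutator_eq_bot [Nonempty ι₁]
    (hX₁ : IsSimple Φ₁) (hη₁ : IsRiemannForm Φ₁ η₁) [IsTotallyReal (centerField Φ₁ hX₁)]
    (h₂ : ⁅hodgeGroupC Φ₂, hodgeGroupC Φ₂⁆ = ⊥) :
    hodgeGroupC (prodPeriod Φ₁ Φ₂) = blockDiagProd (hodgeGroupC Φ₁) (hodgeGroupC Φ₂) :=
  hodgeGroupC_prod_eq_blockDiagProd_of_commutator_eq Φ₁ Φ₂ (hX₁.commutator_hodgeGroupC_eq_self_of_isTotallyReal_centerField hη₁)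
    h₂

/-- The mirror: `Hg(X₁)(ℂ)` commutative, `X₂` simple with totally real centre ⟹ `Hg(X₁ × X₂)(ℂ) = Hg(X₁)(ℂ) × Hg(X₂)(ℂ)`.
[cite: MoonenZarhin1999LowDim, §3 Theorem (3.2)(2)] [cite: Gordon1997, §3 Theorem, proof] -/
theorem IsSimple.hodgeGroupC_prod_eq_blockDiagProd_of_commutator_eq_bot_of_isTotallyReal_centerField [Nonempty ι₂]
    (h₁ : ⁅hodgeGroupC Φ₁, hodgeGroupC Φ₁⁆ = ⊥) (hX₂ : IsSimple Φ₂) (hη₂ : IsRiemannForm Φ₂ η₂)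
    [IsTotallyReal (centerField Φ₂ hX₂)] :
    hodgeGroupC (prodPeriod Φ₁ Φ₂) = blockDiagProd (hodgeGroupC Φ₁) (hodgeGroupC Φ₂) :=
  hodgeGroupC_prod_eq_blockDiagProd_of_commutator_eq_bot_of_commutator_eq Φ₁ Φ₂ h₁
    (hX₂.commutator_hodgeGroupC_eq_self_of_isTotallyReal_centerField hη₂)

/-- (D)-transfer: `X₁` simple with totally real centre, `Hg(X₂)(ℂ)` commutative, both stably nondegenerate ⟹ `X₁ × X₂`
stably nondegenerate («Then `X₁ × X₂` again satisfies (D)»). [cite: MoonenZarhin1999LowDim, §3 Theorem (3.2)(2) and §1 (condition (D))]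
[cite: Gordon1997, Thm. 7.6.2] -/
theorem IsSimple.forall_divisorClasses_powPeriod_prod_eq_hodgeClasses_of_isTotallyReal_centerField_of_commutator_eq_bot
    [Nonempty ι₁] (hX₁ : IsSimple Φ₁) (hη₁ : IsRiemannForm Φ₁ η₁) [IsTotallyReal (centerField Φ₁ hX₁)]
    (h₂ : ⁅hodgeGroupC Φ₂, hodgeGroupC Φ₂⁆ = ⊥)
    (hD₁ : ∀ k p, divisorClasses (powPeriod Φ₁ k) p = hodgeClasses (powPeriod Φ₁ k) p)
    (hD₂ : ∀ k p, divisorClasses (powPeriod Φ₂ k) p = hodgeClasses (powPeriod Φ₂ k) p) :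
    ∀ k p, divisorClasses (powPeriod (prodPeriod Φ₁ Φ₂) k) p = hodgeClasses (powPeriod (prodPeriod Φ₁ Φ₂) k) p :=
  forall_divisorClasses_powPeriod_prod_eq_hodgeClasses_of_hodgeGroupC_prod_eq
    (hX₁.hodgeGroupC_prod_eq_blockDiagProd_of_isTotallyReal_centerField_of_commutator_eq_bot hη₁ h₂) hD₁ hD₂

/-- `Hg(X)(ℝ)` commutative ⟹ `(Hg(X)(ℂ), Hg(X)(ℂ)) = 1` (bridge). [cite: Gordon1997, §2.12 Proposition]
[cite: Lange2023AbelianVarietiesComplex, §7.2.3 Prop. 7.2.6] -/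
theorem commutator_hodgeGroupC_eq_bot_of_hodgeGroup_comm (h : ∀ M ∈ hodgeGroup Φ₁, ∀ N ∈ hodgeGroup Φ₁, M * N = N * M) :
    ⁅hodgeGroupC Φ₁, hodgeGroupC Φ₁⁆ = ⊥ :=
  (commutator_hodgeGroupC_eq_bot_iff_forall_comm Φ₁).2 ((hodgeGroup_comm_iff_hodgeGroupC_comm Φ₁).1 h)

/-- `(Hg(X)(ℂ), Hg(X)(ℂ)) = 1 ⟹ Hg(X)(ℝ)` commutative (bridge). [cite: Gordon1997, §2.12 Proposition]
[cite: Lange2023AbelianVarietiesComplex, §7.2.3 Prop. 7.2.6] -/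
theorem hodgeGroup_comm_of_commutator_hodgeGroupC_eq_bot (h : ⁅hodgeGroupC Φ₁, hodgeGroupC Φ₁⁆ = ⊥) :
    ∀ M ∈ hodgeGroup Φ₁, ∀ N ∈ hodgeGroup Φ₁, M * N = N * M :=
  (hodgeGroup_comm_iff_hodgeGroupC_comm Φ₁).2 ((commutator_hodgeGroupC_eq_bot_iff_forall_comm Φ₁).1 h)

end AnyDimension

section Helper

/-- A two-dimensional complex torus has a non-empty lattice index type. [cite: Lange2023AbelianVarietiesComplex, §1.1.1] -/
private theorem nonempty_of_finrank_eq_two₁₃₂ {ι : Type*} [Fintype ι] {E : Type*} [NormedAddCommGroup E] [NormedSpace ℂ E]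
    [FiniteDimensional ℂ E] (Φ : (ι → ℝ) ≃L[ℝ] E) (h2 : finrank ℂ E = 2) : Nonempty ι := by
  have hc := card_eq_two_mul_finrank Φ
  exact Fintype.card_pos_iff.1 (by omega)

end Helper

/-! ## §2 Abelian surfaces: a simple `Y` has `Hg(Y)(ℂ)` perfect or commutative; `Y₁ × Y₂` with exactly one commutative Hodge group -/

section Surfaces

variable {ι₁ ι₂ : Type} [Fintype ι₁] [DecidableEq ι₁] [Fintype ι₂] [DecidableEq ι₂]
  {E₁ E₂ : Type} [NormedAddCommGroup E₁] [NormedSpace ℂ E₁] [FiniteDimensional ℂ E₁] [NormedAddCommGroup E₂]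
  [NormedSpace ℂ E₂] [FiniteDimensional ℂ E₂] {Φ₁ : (ι₁ → ℝ) ≃L[ℝ] E₁} {Φ₂ : (ι₂ → ℝ) ≃L[ℝ] E₂}
  {η₁ : E₁ [⋀^Fin 2]→L[ℝ] ℝ} {η₂ : E₂ [⋀^Fin 2]→L[ℝ] ℝ}

/-- **FOR A SIMPLE ABELIAN SURFACE `Hg(Y)(ℂ)` IS PERFECT OR COMMUTATIVE**: the centre of `End_ℚ(Y)` is totally real (types
I(1), I(2), II(1): `Sp₄`, `Res SL₂`, `U_{D^opp}` — perfect) or a CM field (type IV(2,1): `Hg(Y) = U_F`, a torus).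
[cite: MoonenZarhin1999LowDim, §2 (2.2) `g = 2` (p0005 L53–L78) and §1 (p0002 L134–L136)] [cite: Lange2023AbelianVarietiesComplex, §5.1.5 Exercise (2)(b)] -/
theorem IsSimple.commutator_hodgeGroupC_eq_self_or_eq_bot_of_finrank_eq_two (hX : IsSimple Φ₁) (hη : IsRiemannForm Φ₁ η₁)
    (h2 : finrank ℂ E₁ = 2) :
    ⁅hodgeGroupC Φ₁, hodgeGroupC Φ₁⁆ = hodgeGroupC Φ₁ ∨ ⁅hodgeGroupC Φ₁, hodgeGroupC Φ₁⁆ = ⊥ := by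
  haveI : Nonempty ι₁ := nonempty_of_finrank_eq_two₁₃₂ Φ₁ h2
  rcases hX.centerField_isTotallyReal_or_isCMField hη with hK | hK
  · haveI := hK
    exact Or.inl (hX.commutator_hodgeGroupC_eq_self_of_isTotallyReal_centerField hη)
  · haveI := hK
    exact Or.inr (commutator_hodgeGroupC_eq_bot_of_hodgeGroup_comm (hX.hodgeGroup_comm_of_isCMField_of_finrank_eq_two hη h2))

/-- A simple abelian surface with NON-commutative Hodge group has totally real centre (type IV(2,1) has `Hg = U_F` commutative).
[cite: MoonenZarhin1999LowDim, §2 (2.2) `g = 2` («Type IV(2,1): `Hg(X) = U_F`»)] [cite: Lange2023AbelianVarietiesComplex, §5.1.5 Exercise (2)(b)] -/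
theorem IsSimple.isTotallyReal_centerField_of_not_hodgeGroup_comm_of_finrank_eq_two [Nonempty ι₁] (hX : IsSimple Φ₁)
    (hη : IsRiemannForm Φ₁ η₁) (h2 : finrank ℂ E₁ = 2) (hnc : ¬ ∀ M ∈ hodgeGroup Φ₁, ∀ N ∈ hodgeGroup Φ₁, M * N = N * M) :
    IsTotallyReal (centerField Φ₁ hX) :=
  (hX.centerField_isTotallyReal_or_isCMField hη).resolve_right fun hK ↦
    hnc (haveI := hK; hX.hodgeGroup_comm_of_isCMField_of_finrank_eq_two hη h2)

/-- **A simple abelian surface with non-commutative Hodge group has PERFECT `Hg(Y)(ℂ)`** (types I(1), I(2), II(1)).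
[cite: MoonenZarhin1999LowDim, §1 (p0002 L134–L136) and §2 (2.2) `g = 2`] [cite: Gordon1997, §2.9 Proposition] -/
theorem IsSimple.commutator_hodgeGroupC_eq_self_of_not_hodgeGroup_comm_of_finrank_eq_two (hX : IsSimple Φ₁)
    (hη : IsRiemannForm Φ₁ η₁) (h2 : finrank ℂ E₁ = 2) (hnc : ¬ ∀ M ∈ hodgeGroup Φ₁, ∀ N ∈ hodgeGroup Φ₁, M * N = N * M) :
    ⁅hodgeGroupC Φ₁, hodgeGroupC Φ₁⁆ = hodgeGroupC Φ₁ :=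
  (hX.commutator_hodgeGroupC_eq_self_or_eq_bot_of_finrank_eq_two hη h2).resolve_right fun h ↦
    hnc (hodgeGroup_comm_of_commutator_hodgeGroupC_eq_bot h)

omit [FiniteDimensional ℂ E₁] in
/-- **`Y₁` with commutative Hodge group (CM type), `Y₂` a SIMPLE abelian surface with non-commutative Hodge group ⟹
`Hg(Y₁ × Y₂)(ℂ) = Hg(Y₁)(ℂ) × Hg(Y₂)(ℂ)`** (`Y₁` any complex torus). [cite: MoonenZarhin1999LowDim, §3 Theorem (3.2)(2) and §5 (5.4)]
[cite: Gordon1997, §3 Theorem, proof] -/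
theorem IsSimple.hodgeGroupC_prod_eq_blockDiagProd_of_hodgeGroup_comm_of_not_hodgeGroup_comm_of_finrank_eq_two
    (h₁ : ∀ M ∈ hodgeGroup Φ₁, ∀ N ∈ hodgeGroup Φ₁, M * N = N * M) (hX₂ : IsSimple Φ₂) (hη₂ : IsRiemannForm Φ₂ η₂)
    (h2₂ : finrank ℂ E₂ = 2) (hnc₂ : ¬ ∀ M ∈ hodgeGroup Φ₂, ∀ N ∈ hodgeGroup Φ₂, M * N = N * M) :
    hodgeGroupC (prodPeriod Φ₁ Φ₂) = blockDiagProd (hodgeGroupC Φ₁) (hodgeGroupC Φ₂) :=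
  hodgeGroupC_prod_eq_blockDiagProd_of_commutator_eq_bot_of_commutator_eq Φ₁ Φ₂ (commutator_hodgeGroupC_eq_bot_of_hodgeGroup_comm h₁)
    (hX₂.commutator_hodgeGroupC_eq_self_of_not_hodgeGroup_comm_of_finrank_eq_two hη₂ h2₂ hnc₂)

omit [FiniteDimensional ℂ E₂] in
/-- The mirror: `Y₁` simple surface with non-commutative, `Y₂` with commutative Hodge group ⟹ the Hodge group of `Y₁ × Y₂` splits.
[cite: MoonenZarhin1999LowDim, §3 Theorem (3.2)(2) and §5 (5.4)] [cite: Gordon1997, §3 Theorem, proof] -/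
theorem IsSimple.hodgeGroupC_prod_eq_blockDiagProd_of_not_hodgeGroup_comm_of_hodgeGroup_comm_of_finrank_eq_two
    (hX₁ : IsSimple Φ₁) (hη₁ : IsRiemannForm Φ₁ η₁) (h2₁ : finrank ℂ E₁ = 2)
    (hnc₁ : ¬ ∀ M ∈ hodgeGroup Φ₁, ∀ N ∈ hodgeGroup Φ₁, M * N = N * M)
    (h₂ : ∀ M ∈ hodgeGroup Φ₂, ∀ N ∈ hodgeGroup Φ₂, M * N = N * M) :
    hodgeGroupC (prodPeriod Φ₁ Φ₂) = blockDiagProd (hodgeGroupC Φ₁) (hodgeGroupC Φ₂) :=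
  hodgeGroupC_prod_eq_blockDiagProd_of_commutator_eq Φ₁ Φ₂
    (hX₁.commutator_hodgeGroupC_eq_self_of_not_hodgeGroup_comm_of_finrank_eq_two hη₁ h2₁ hnc₁)
    (commutator_hodgeGroupC_eq_bot_of_hodgeGroup_comm h₂)

/-- **(D) FOR `Y₁ × Y₂` WHEN EXACTLY ONE HODGE GROUP IS COMMUTATIVE, I**: `Y₁`, `Y₂` polarised abelian surfaces, `Hg(Y₁)`
commutative (CM type), `Hg(Y₂)` not commutative ⟹ every power of `Y₁ × Y₂` has its Hodge ring generated by divisor classes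
(`Y₂` non-simple: g51-#7; `Y₂` simple: the Hodge group splits and both surfaces satisfy (D)).
[cite: MoonenZarhin1999LowDim, Thm. (0.1)(4) (p0001 L131–L135), §3 Theorem (3.2)(2), §5 (5.4)–(5.5) (p0009 L82–L100)] [cite: Gordon1997, Thm. 7.6.2] -/
theorem IsRiemannForm.forall_divisorClasses_powPeriod_prod_eq_hodgeClasses_of_hodgeGroup_comm_of_not_hodgeGroup_comm_of_finrank_eq_two
    (hη₁ : IsRiemannForm Φ₁ η₁) (hη₂ : IsRiemannForm Φ₂ η₂) (h2₁ : finrank ℂ E₁ = 2) (h2₂ : finrank ℂ E₂ = 2)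
    (h₁ : ∀ M ∈ hodgeGroup Φ₁, ∀ N ∈ hodgeGroup Φ₁, M * N = N * M)
    (hnc₂ : ¬ ∀ M ∈ hodgeGroup Φ₂, ∀ N ∈ hodgeGroup Φ₂, M * N = N * M) :
    ∀ k p, divisorClasses (powPeriod (prodPeriod Φ₁ Φ₂) k) p = hodgeClasses (powPeriod (prodPeriod Φ₁ Φ₂) k) p := by
  haveI : Nonempty ι₁ := nonempty_of_finrank_eq_two₁₃₂ Φ₁ h2₁
  haveI : Nonempty ι₂ := nonempty_of_finrank_eq_two₁₃₂ Φ₂ h2₂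
  by_cases hX₂ : IsSimple Φ₂
  · exact forall_divisorClasses_powPeriod_prod_eq_hodgeClasses_of_hodgeGroupC_prod_eq
      (hX₂.hodgeGroupC_prod_eq_blockDiagProd_of_hodgeGroup_comm_of_not_hodgeGroup_comm_of_finrank_eq_two h₁ hη₂ h2₂ hnc₂)
      (IsAbelianVariety.forall_divisorClasses_powPeriod_eq_hodgeClasses_of_finrank_eq_two ⟨η₁, hη₁⟩ h2₁)
      (IsAbelianVariety.forall_divisorClasses_powPeriod_eq_hodgeClasses_of_finrank_eq_two ⟨η₂, hη₂⟩ h2₂)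
  · exact hη₁.forall_divisorClasses_powPeriod_prod_eq_hodgeClasses_of_finrank_eq_two_of_not_isSimple_or_isIsogenous hη₂ h2₁ h2₂
      (Or.inr (Or.inl hX₂))

/-- **(D) FOR `Y₁ × Y₂` WHEN EXACTLY ONE HODGE GROUP IS COMMUTATIVE, II** (the mirror: `Hg(Y₁)` not commutative, `Hg(Y₂)`
commutative). [cite: MoonenZarhin1999LowDim, Thm. (0.1)(4), §3 Theorem (3.2)(2), §5 (5.4)–(5.5)] [cite: Gordon1997, Thm. 7.6.2] -/
theorem IsRiemannForm.forall_divisorClasses_powPeriod_prod_eq_hodgeClasses_of_not_hodgeGroup_comm_of_hodgeGroup_comm_of_finrank_eq_two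
    (hη₁ : IsRiemannForm Φ₁ η₁) (hη₂ : IsRiemannForm Φ₂ η₂) (h2₁ : finrank ℂ E₁ = 2) (h2₂ : finrank ℂ E₂ = 2)
    (hnc₁ : ¬ ∀ M ∈ hodgeGroup Φ₁, ∀ N ∈ hodgeGroup Φ₁, M * N = N * M)
    (h₂ : ∀ M ∈ hodgeGroup Φ₂, ∀ N ∈ hodgeGroup Φ₂, M * N = N * M) :
    ∀ k p, divisorClasses (powPeriod (prodPeriod Φ₁ Φ₂) k) p = hodgeClasses (powPeriod (prodPeriod Φ₁ Φ₂) k) p := by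
  haveI : Nonempty ι₁ := nonempty_of_finrank_eq_two₁₃₂ Φ₁ h2₁
  haveI : Nonempty ι₂ := nonempty_of_finrank_eq_two₁₃₂ Φ₂ h2₂
  by_cases hX₁ : IsSimple Φ₁
  · exact forall_divisorClasses_powPeriod_prod_eq_hodgeClasses_of_hodgeGroupC_prod_eq
      (hX₁.hodgeGroupC_prod_eq_blockDiagProd_of_not_hodgeGroup_comm_of_hodgeGroup_comm_of_finrank_eq_two hη₁ h2₁ hnc₁ h₂)
      (IsAbelianVariety.forall_divisorClasses_powPeriod_eq_hodgeClasses_of_finrank_eq_two ⟨η₁, hη₁⟩ h2₁)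
      (IsAbelianVariety.forall_divisorClasses_powPeriod_eq_hodgeClasses_of_finrank_eq_two ⟨η₂, hη₂⟩ h2₂)
  · exact hη₁.forall_divisorClasses_powPeriod_prod_eq_hodgeClasses_of_finrank_eq_two_of_not_isSimple_or_isIsogenous hη₂ h2₁ h2₂
      (Or.inl hX₁)

/-- **MOONEN–ZARHIN THM. (0.1)(4) FOR `Y₁ × Y₂`: THE STATE OF THE TREE.**  Polarised abelian surfaces `Y₁`, `Y₂` with
`End_ℚ(Y₁) = ℚ`, or `End_ℚ(Y₂) = ℚ`, or `Y₁` or `Y₂` non-simple, or `Y₂ ∼ Y₁`, or EXACTLY ONE of `Hg(Y₁)`, `Hg(Y₂)` commutative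
⟹ `Y₁ × Y₂` satisfies condition (D).  (What remains is «both simple, non-isogenous, `End_ℚ ≠ ℚ`, and both Hodge groups
commutative (CM × CM: Prop. (4.2)) or both non-commutative (types I(2) ∕ II(1): Thm. (3.2)(1))».)
[cite: MoonenZarhin1999LowDim, Thm. (0.1)(4) (p0001 L131–L135) and §5 (5.4)–(5.5) (p0009 L82–L100)] -/
theorem IsRiemannForm.forall_divisorClasses_powPeriod_prod_eq_hodgeClasses_of_finrank_eq_two_of_endAlgRat_eq_bot_or'
    (hη₁ : IsRiemannForm Φ₁ η₁) (hη₂ : IsRiemannForm Φ₂ η₂) (h2₁ : finrank ℂ E₁ = 2) (h2₂ : finrank ℂ E₂ = 2)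
    (h : endAlgRat Φ₁ = ⊥ ∨ endAlgRat Φ₂ = ⊥ ∨ ¬ IsSimple Φ₁ ∨ ¬ IsSimple Φ₂ ∨ IsIsogenous Φ₂ Φ₁ ∨
      ((∀ M ∈ hodgeGroup Φ₁, ∀ N ∈ hodgeGroup Φ₁, M * N = N * M) ∧ ¬ ∀ M ∈ hodgeGroup Φ₂, ∀ N ∈ hodgeGroup Φ₂, M * N = N * M) ∨
      ((¬ ∀ M ∈ hodgeGroup Φ₁, ∀ N ∈ hodgeGroup Φ₁, M * N = N * M) ∧ ∀ M ∈ hodgeGroup Φ₂, ∀ N ∈ hodgeGroup Φ₂, M * N = N * M)) :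
    ∀ k p, divisorClasses (powPeriod (prodPeriod Φ₁ Φ₂) k) p = hodgeClasses (powPeriod (prodPeriod Φ₁ Φ₂) k) p := by
  rcases h with h | h | h | h | h | ⟨h₁, h₂⟩ | ⟨h₁, h₂⟩
  · exact hη₁.forall_divisorClasses_powPeriod_prod_eq_hodgeClasses_of_finrank_eq_two_of_endAlgRat_eq_bot_or hη₂ h2₁ h2₂ (Or.inl h)
  · exact hη₁.forall_divisorClasses_powPeriod_prod_eq_hodgeClasses_of_finrank_eq_two_of_endAlgRat_eq_bot_or hη₂ h2₁ h2₂
      (Or.inr (Or.inl h))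
  · exact hη₁.forall_divisorClasses_powPeriod_prod_eq_hodgeClasses_of_finrank_eq_two_of_not_isSimple_or_isIsogenous hη₂ h2₁ h2₂
      (Or.inl h)
  · exact hη₁.forall_divisorClasses_powPeriod_prod_eq_hodgeClasses_of_finrank_eq_two_of_not_isSimple_or_isIsogenous hη₂ h2₁ h2₂
      (Or.inr (Or.inl h))
  · exact hη₁.forall_divisorClasses_powPeriod_prod_eq_hodgeClasses_of_finrank_eq_two_of_not_isSimple_or_isIsogenous hη₂ h2₁ h2₂
      (Or.inr (Or.inr h))
  · exact hη₁.forall_divisorClasses_powPeriod_prod_eq_hodgeClasses_of_hodgeGroup_comm_of_not_hodgeGroup_comm_of_finrank_eq_two hη₂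
      h2₁ h2₂ h₁ h₂
  · exact hη₁.forall_divisorClasses_powPeriod_prod_eq_hodgeClasses_of_not_hodgeGroup_comm_of_hodgeGroup_comm_of_finrank_eq_two hη₂
      h2₁ h2₂ h₁ h₂

/-- `IsAbelianVariety` form of the assembly. [cite: MoonenZarhin1999LowDim, Thm. (0.1)(4) and §5 (5.4)–(5.5)] -/
theorem IsAbelianVariety.forall_divisorClasses_powPeriod_prod_eq_hodgeClasses_of_finrank_eq_two_of_endAlgRat_eq_bot_or'
    (hS₁ : IsAbelianVariety Φ₁) (hS₂ : IsAbelianVariety Φ₂) (h2₁ : finrank ℂ E₁ = 2) (h2₂ : finrank ℂ E₂ = 2)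
    (h : endAlgRat Φ₁ = ⊥ ∨ endAlgRat Φ₂ = ⊥ ∨ ¬ IsSimple Φ₁ ∨ ¬ IsSimple Φ₂ ∨ IsIsogenous Φ₂ Φ₁ ∨
      ((∀ M ∈ hodgeGroup Φ₁, ∀ N ∈ hodgeGroup Φ₁, M * N = N * M) ∧ ¬ ∀ M ∈ hodgeGroup Φ₂, ∀ N ∈ hodgeGroup Φ₂, M * N = N * M) ∨
      ((¬ ∀ M ∈ hodgeGroup Φ₁, ∀ N ∈ hodgeGroup Φ₁, M * N = N * M) ∧ ∀ M ∈ hodgeGroup Φ₂, ∀ N ∈ hodgeGroup Φ₂, M * N = N * M)) :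
    ∀ k p, divisorClasses (powPeriod (prodPeriod Φ₁ Φ₂) k) p = hodgeClasses (powPeriod (prodPeriod Φ₁ Φ₂) k) p := by
  obtain ⟨η₁, hη₁⟩ := hS₁
  obtain ⟨η₂, hη₂⟩ := hS₂
  exact hη₁.forall_divisorClasses_powPeriod_prod_eq_hodgeClasses_of_finrank_eq_two_of_endAlgRat_eq_bot_or' hη₂ h2₁ h2₂ h

variable {ι : Type} [Fintype ι] [DecidableEq ι] {E : Type} [NormedAddCommGroup E] [NormedSpace ℂ E] {Φ : (ι → ℝ) ≃L[ℝ] E}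

/-- **Every complex torus isogenous to such a `Y₁ × Y₂` satisfies condition (D).**
[cite: MoonenZarhin1999LowDim, Thm. (0.1)(4) and §5 (5.4)–(5.5) (p0009 L82–L100)] -/
theorem IsIsogenous.forall_divisorClasses_powPeriod_eq_hodgeClasses_of_prod_of_finrank_eq_two_of_endAlgRat_eq_bot_or'
    (hiso : IsIsogenous Φ (prodPeriod Φ₁ Φ₂)) (hη₁ : IsRiemannForm Φ₁ η₁) (hη₂ : IsRiemannForm Φ₂ η₂)
    (h2₁ : finrank ℂ E₁ = 2) (h2₂ : finrank ℂ E₂ = 2)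
    (h : endAlgRat Φ₁ = ⊥ ∨ endAlgRat Φ₂ = ⊥ ∨ ¬ IsSimple Φ₁ ∨ ¬ IsSimple Φ₂ ∨ IsIsogenous Φ₂ Φ₁ ∨
      ((∀ M ∈ hodgeGroup Φ₁, ∀ N ∈ hodgeGroup Φ₁, M * N = N * M) ∧ ¬ ∀ M ∈ hodgeGroup Φ₂, ∀ N ∈ hodgeGroup Φ₂, M * N = N * M) ∨
      ((¬ ∀ M ∈ hodgeGroup Φ₁, ∀ N ∈ hodgeGroup Φ₁, M * N = N * M) ∧ ∀ M ∈ hodgeGroup Φ₂, ∀ N ∈ hodgeGroup Φ₂, M * N = N * M)) :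
    ∀ k p, divisorClasses (powPeriod Φ k) p = hodgeClasses (powPeriod Φ k) p :=
  hiso.forall_powPeriod_divisorClasses_eq_hodgeClasses_iff.2
    (hη₁.forall_divisorClasses_powPeriod_prod_eq_hodgeClasses_of_finrank_eq_two_of_endAlgRat_eq_bot_or' hη₂ h2₁ h2₂ h)

universe u

variable {κ : Type*} [Fintype κ] [DecidableEq κ] {E' : Type u} [NormedAddCommGroup E'] [InnerProductSpace ℂ E']
  [FiniteDimensional ℂ E'] [MeasurableSpace E'] [BorelSpace E'] (Ψ : (κ → ℝ) ≃L[ℝ] E') {q : ℕ} (e : Fin q ≃ κ)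

/-- Cycle form `Aᵖ = Bᵖ` for every inner-product torus isogenous to a power of such a `Y₁ × Y₂`.
[cite: MoonenZarhin1999LowDim, Thm. (0.1)(4) and §1 (1.5) (p0004 L61–L66)] [cite: Lange2023AbelianVarietiesComplex, §7.3.3 Exercise (1)(b)] -/
theorem IsIsogenous.forall_analyticClasses_eq_hodgeClasses_of_powPeriod_prod_of_finrank_eq_two_of_endAlgRat_eq_bot_or' {k : ℕ}
    (hY : IsIsogenous Ψ (powPeriod (prodPeriod Φ₁ Φ₂) k)) (hS₁ : IsAbelianVariety Φ₁) (hS₂ : IsAbelianVariety Φ₂)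
    (h2₁ : finrank ℂ E₁ = 2) (h2₂ : finrank ℂ E₂ = 2)
    (h : endAlgRat Φ₁ = ⊥ ∨ endAlgRat Φ₂ = ⊥ ∨ ¬ IsSimple Φ₁ ∨ ¬ IsSimple Φ₂ ∨ IsIsogenous Φ₂ Φ₁ ∨
      ((∀ M ∈ hodgeGroup Φ₁, ∀ N ∈ hodgeGroup Φ₁, M * N = N * M) ∧ ¬ ∀ M ∈ hodgeGroup Φ₂, ∀ N ∈ hodgeGroup Φ₂, M * N = N * M) ∨
      ((¬ ∀ M ∈ hodgeGroup Φ₁, ∀ N ∈ hodgeGroup Φ₁, M * N = N * M) ∧ ∀ M ∈ hodgeGroup Φ₂, ∀ N ∈ hodgeGroup Φ₂, M * N = N * M))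
    (p : ℕ) : analyticClasses Ψ e p = hodgeClasses Ψ p :=
  hY.forall_analyticClasses_eq_hodgeClasses_of_powPeriod_of_forall_powPeriod Ψ e (hS₁.prod hS₂)
    (hS₁.forall_divisorClasses_powPeriod_prod_eq_hodgeClasses_of_finrank_eq_two_of_endAlgRat_eq_bot_or' hS₂ h2₁ h2₂ h) p

end Surfaces

end ComplexTorus

end Literature.Geometry.Kaehler
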